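import Literature.Geometry.Lorentzian.ObstructionFreeGluingProofs
import Literature.Geometry.Lorentzian.ObstructionFreeGluingCoord
import Literature.Geometry.Lorentzian.InitialDataDilation
import HarnessLib

/-!
# The annular gluing theorem reduced to fields on `ℝ³` (coordinate form of Mao–Oh–Tao's Thm 1.7)

(trunk G08 = T-LORENTZ; family `gr`; namespaces `Literature.Geometry.Lorentzian.InitialDataSet`, `….MaoOhTao`.)

The fact `MaoOhTao.ObstructionFreeAnnularGluing` (`ObstructionFreeGluing.lean`; Mao–Oh–Tao 2023, Thm 1.7 with Rem 1.9)
quantifies over smooth initial data sets `Din, Dout` on `ℝ³` (bundled Riemannian metric + symmetric tensor) and asks for a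
glued datum `D`; all its hypotheses, however, are stated through the coefficient maps `coordH, coordK` (the deviation
`DevLE`, the averaged charges `avgE, avgP, avgC, avgJ`) and the shell vacuum predicate `VacOn`, which is the coordinate
constraint system `hamAt = 0, momFn = 0` (`ObstructionFreeGluingCoord.lean`).  The paper itself works throughout with
the components `(g_{ij}, k_{ij})` on `ℝ³` (§2.1).  This file removes the bundle packaging:

* `InitialDataSet.exists_of_fields` — smooth fields `G, K : ℝ³ → Bilin(ℝ³)`, `G` symmetric positive definite, `K`
  symmetric, ARE the coefficient maps of a smooth initial data set on `ℝ³` (the tangent bundle of `ℝ³` is trivial,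
  `contMDiffAt_bilinE3_iff`; unit balls of `G_y` are bounded by compactness of the unit sphere);
* `MaoOhTao.core_of_fields` — a solution `(G, K)` of the coordinate constraint equations on `{1 < |y| < 64}` agreeing
  with the components of `Din` on `A₁` and of `Dout` on `A₃₂` yields the conclusion of the fact (`assembly`);
* `MaoOhTao.ObstructionFreeAnnularGluing_of_coord` — **reduction**: the fact follows from its coordinate form, the same
  statement for smooth component fields `(G_in, K_in)`, `(G_out, K_out)` and a glued field `(G, K)` on `ℝ³`
  (Thm 1.7 + Rem 1.9 exactly as the paper phrases it, for `C^∞` components); `coord_of_ObstructionFreeAnnularGluing`,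
  `ObstructionFreeAnnularGluing_iff_coord` — the converse and the equivalence.

Everything is proved; no definitions, no named facts.  The coordinate form is an explicit hypothesis of the reduction
theorem, not a new fact.

## References

* Y. Mao, S.-J. Oh, T. Tao, arXiv:2308.13031 (2023), Thm 1.7, Rem 1.9, §2.1 (2.6)–(2.7) (key `MaoOhTao2023`).
-/

noncomputable section

open scoped Manifold ContDiff Topology
open Set Metric Function Bundle

namespace Literature.Geometry.Lorentzian

namespace InitialDataSet

/-- **The unit ball of a positive definite form on `ℝ³` is bounded** (minimum of the form on the compact unit sphere).
[folklore] -/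
theorem isVonNBounded_of_pos (B : E3 →L[ℝ] E3 →L[ℝ] ℝ) (hpos : ∀ v, v ≠ 0 → 0 < B v v) :
    Bornology.IsVonNBounded ℝ {v : E3 | B v v < 1} := by
  have hq : Continuous fun v : E3 ↦ B v v := B.continuous₂.comp (continuous_id.prodMk continuous_id)
  obtain ⟨v₀, hv₀, hmin⟩ := (isCompact_sphere (0 : E3) 1).exists_isMinOn
    (NormedSpace.sphere_nonempty.2 zero_le_one) hq.continuousOn
  set m : ℝ := B v₀ v₀ with hm
  have hv₀0 : v₀ ≠ 0 := by
    intro h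
    rw [h, mem_sphere_zero_iff_norm, norm_zero] at hv₀
    exact zero_ne_one hv₀
  have hm0 : 0 < m := hpos v₀ hv₀0
  rw [NormedSpace.isVonNBounded_iff]
  refine (isBounded_ball (x := (0 : E3)) (r := 1 / m + 1)).subset fun v hv ↦ ?_
  rw [mem_ball, dist_zero_right]
  have hv' : B v v < 1 := hv
  by_cases hv0 : v = 0
  · rw [hv0, norm_zero]; positivity
  have hn : 0 < ‖v‖ := norm_pos_iff.2 hv0
  -- `B v v = |v|² B(v̂, v̂) ≥ m |v|²`
  have hu : ‖v‖⁻¹ • v ∈ sphere (0 : E3) 1 := by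
    rw [mem_sphere_zero_iff_norm, norm_smul, norm_inv, norm_norm, inv_mul_cancel₀ hn.ne']
  have hmu : m ≤ B (‖v‖⁻¹ • v) (‖v‖⁻¹ • v) := hmin hu
  have hscale : B (‖v‖⁻¹ • v) (‖v‖⁻¹ • v) = ‖v‖⁻¹ * (‖v‖⁻¹ * B v v) := by
    simp only [map_smul, FunLike.coe_smul, Pi.smul_apply, smul_eq_mul]
  rw [hscale] at hmu
  have h2 : m * ‖v‖ ^ 2 ≤ B v v := by
    have := mul_le_mul_of_nonneg_left hmu (sq_nonneg ‖v‖)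
    calc m * ‖v‖ ^ 2 = ‖v‖ ^ 2 * m := by ring
      _ ≤ ‖v‖ ^ 2 * (‖v‖⁻¹ * (‖v‖⁻¹ * B v v)) := this
      _ = B v v := by field_simp
  have h3 : m * ‖v‖ ^ 2 < 1 := h2.trans_lt hv'
  have hm1 : (0 : ℝ) < 1 / m := by positivity
  by_cases h1 : ‖v‖ ≤ 1
  · linarith
  · push Not at h1
    have h4 : m * ‖v‖ < 1 := by nlinarith
    have h5 : ‖v‖ < 1 / m := by rw [lt_div_iff₀ hm0]; linarith
    linarith

/-- **Initial data on `ℝ³` from component fields.** Smooth fields `G, K : ℝ³ → Bilin(ℝ³)` with `G` symmetric and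
positive definite and `K` symmetric are the coefficient maps `coordH, coordK` of a smooth initial data set on `ℝ³`
(the bilinear-form bundle of `ℝ³` is trivialised by the identity). [folklore] -/
theorem exists_of_fields (G K : E3 → E3 →L[ℝ] E3 →L[ℝ] ℝ) (hG : ContDiff ℝ ∞ G) (hK : ContDiff ℝ ∞ K)
    (hGs : ∀ y v w, G y v w = G y w v) (hGp : ∀ y v, v ≠ 0 → 0 < G y v v) (hKs : ∀ y v w, K y v w = K y w v) :
    ∃ D : InitialDataSet (𝓡 3) E3, D.coordH = G ∧ D.coordK = K := by
  have hbdd : ∀ y : E3, Bornology.IsVonNBounded ℝ {v : TangentSpace (𝓡 3) y | G y v v < 1} :=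
    fun y ↦ isVonNBounded_of_pos (G y) (hGp y)
  refine ⟨{ h := { inner := G, symm := hGs, pos := hGp, isVonNBounded := hbdd, contMDiff := ?_ },
            k := K, k_symm := hKs, contMDiff_k := ?_ }, rfl, rfl⟩
  · intro y
    rw [contMDiffAt_bilinE3_iff]
    exact ⟨contMDiffAt_id, contMDiffAt_iff_contDiffAt.2 hG.contDiffAt⟩
  · intro y
    rw [contMDiffAt_bilinE3_iff]
    exact ⟨contMDiffAt_id, contMDiffAt_iff_contDiffAt.2 hK.contDiffAt⟩

end InitialDataSet

namespace MaoOhTao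

open InitialDataSet
open _root_.Module (Basis)

/-- **The conclusion of the fact from a coordinate solution.** If smooth fields `(G, K)` on `ℝ³` (`G` symmetric positive
definite, `K` symmetric) solve the coordinate constraint equations `hamAt G K = 0`, `momFn b G K = 0` on `{1 < |y| < 64}`
and coincide with the components of `Din` on `A₁ = {1 < |y| < 2}` and with those of `Dout` on `A₃₂ = {32 < |y| < 64}`,
then there is a smooth datum on `ℝ³` solving the constraints on `{1 < |y| < 64}` which is `Din` on `B₂` and `Dout`
outside `B̄₃₂` (`exists_of_fields`, `VacOn_iff_coord`, `assembly`). [cite: MaoOhTao2023, Thm 1.7 and Rem 1.9] -/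
theorem core_of_fields {ι : Type*} [Fintype ι] (b : Basis ι ℝ E3) {Din Dout : InitialDataSet (𝓡 3) E3}
    (G K : E3 → E3 →L[ℝ] E3 →L[ℝ] ℝ) (hG : ContDiff ℝ ∞ G) (hK : ContDiff ℝ ∞ K)
    (hGs : ∀ y v w, G y v w = G y w v) (hGp : ∀ y v, v ≠ 0 → 0 < G y v v) (hKs : ∀ y v w, K y v w = K y w v)
    (hin : ∀ y : E3, 1 < ‖y‖ → ‖y‖ < 2 → G y = Din.coordH y ∧ K y = Din.coordK y)
    (hout : ∀ y : E3, 32 < ‖y‖ → ‖y‖ < 64 → G y = Dout.coordH y ∧ K y = Dout.coordK y)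
    (hvac : ∀ y : E3, 1 < ‖y‖ → ‖y‖ < 64 →
      MetricCoord.hamAt G K y = 0 ∧ ∀ v : E3, MetricCoord.momFn b G K y v = 0) :
    ∃ D : InitialDataSet (𝓡 3) E3,
      D.VacOn 1 64 ∧ (∀ y : E3, ‖y‖ < 2 → D.SameAt Din y) ∧ (∀ y : E3, 32 < ‖y‖ → D.SameAt Dout y) := by
  obtain ⟨Dmid, hH, hK'⟩ := exists_of_fields G K hG hK hGs hGp hKs
  have hV : Dmid.VacOn 1 64 := by
    rw [VacOn_iff_coord b, hH, hK']
    exact hvac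
  refine assembly hV (fun y h1 h2 ↦ ?_) (fun y h1 h2 ↦ ?_)
  · obtain ⟨h₁, h₂⟩ := hin y h1 h2
    refine ⟨?_, ?_⟩
    · show Dmid.coordH y = Din.coordH y
      rw [hH, h₁]
    · show Dmid.coordK y = Din.coordK y
      rw [hK', h₂]
  · obtain ⟨h₁, h₂⟩ := hout y h1 h2
    refine ⟨?_, ?_⟩
    · show Dmid.coordH y = Dout.coordH y
      rw [hH, h₁]
    · show Dmid.coordK y = Dout.coordK y
      rw [hK', h₂]

/-- **Reduction of the fact to its coordinate form.** `ObstructionFreeAnnularGluing` follows from the same statement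
for smooth component fields on `ℝ³`: for every bump `η` there are `ε_o, μ_o > 0` such that for all smooth
`(G_in, K_in)`, `(G_out, K_out)` (`G`'s symmetric positive definite, `K`'s symmetric) solving the coordinate constraint
equations `hamAt = 0, momFn = 0` on `A₁ = {1 < |y| < 2}`, resp. `A₃₂ = {32 < |y| < 64}`, with deviations
`DevLE … s_in`, `DevLE … s_out` and averaged charge differences satisfying the five inequalities of the fact, there are
smooth fields `(G, K)` on `ℝ³` (`G` symmetric positive definite, `K` symmetric) equal to `(G_in, K_in)` on `A₁`, to
`(G_out, K_out)` on `A₃₂`, and solving `hamAt = 0, momFn = 0` on `{1 < |y| < 64}` — Thm 1.7 with Rem 1.9 in the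
components `(g_{ij}, k_{ij})` the paper works with (§2.1).  (The data `Din, Dout` of the fact have smooth symmetric,
positive definite components, `VacOn` is the coordinate system by `VacOn_iff_coord`, and the glued fields give the
glued datum by `core_of_fields`.) [cite: MaoOhTao2023, Thm 1.7, Rem 1.9, §2.1] -/
theorem ObstructionFreeAnnularGluing_of_coord
    (hcoord : ∀ η : ℝ → ℝ, IsBump η →
      ∃ εo μo : ℝ, 0 < εo ∧ 0 < μo ∧
        ∀ (Gin Kin Gout Kout : E3 → E3 →L[ℝ] E3 →L[ℝ] ℝ) (sIn sOut : ℝ),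
          ContDiff ℝ ∞ Gin → ContDiff ℝ ∞ Kin → ContDiff ℝ ∞ Gout → ContDiff ℝ ∞ Kout →
          (∀ y v w, Gin y v w = Gin y w v) → (∀ y v, v ≠ 0 → 0 < Gin y v v) → (∀ y v w, Kin y v w = Kin y w v) →
          (∀ y v w, Gout y v w = Gout y w v) → (∀ y v, v ≠ 0 → 0 < Gout y v v) →
          (∀ y v w, Kout y v w = Kout y w v) →
          (∀ y : E3, 1 < ‖y‖ → ‖y‖ < 2 → MetricCoord.hamAt Gin Kin y = 0 ∧
            ∀ v : E3, MetricCoord.momFn (EuclideanSpace.basisFun (Fin 3) ℝ).toBasis Gin Kin y v = 0) →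
          (∀ y : E3, 32 < ‖y‖ → ‖y‖ < 64 → MetricCoord.hamAt Gout Kout y = 0 ∧
            ∀ v : E3, MetricCoord.momFn (EuclideanSpace.basisFun (Fin 3) ℝ).toBasis Gout Kout y v = 0) →
          DevLE Gin Kin 1 2 sIn → DevLE Gout Kout 32 64 sOut →
          letI ΔE := avgE η 32 Gout - avgE η 1 Gin
          letI ΔP := fun i ↦ avgP η 32 Kout i - avgP η 1 Kin i
          letI ΔC := fun i ↦ avgC η 32 Gout i - avgC η 1 Gin i
          letI ΔJ := fun i ↦ avgJ η 32 Kout i - avgJ η 1 Kin i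
          Real.sqrt (∑ i, ΔP i ^ 2) < ΔE →
          ΔE < 2 * Real.sqrt (ΔE ^ 2 - ∑ i, ΔP i ^ 2) →
          ΔE < εo ^ 2 →
          Real.sqrt (∑ i, ΔC i ^ 2) + Real.sqrt (∑ i, ΔJ i ^ 2) < μo * ΔE →
          sIn ^ 2 + sOut ^ 2 < μo * ΔE →
          ∃ G K : E3 → E3 →L[ℝ] E3 →L[ℝ] ℝ, ContDiff ℝ ∞ G ∧ ContDiff ℝ ∞ K ∧
            (∀ y v w, G y v w = G y w v) ∧ (∀ y v, v ≠ 0 → 0 < G y v v) ∧ (∀ y v w, K y v w = K y w v) ∧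
            (∀ y : E3, 1 < ‖y‖ → ‖y‖ < 2 → G y = Gin y ∧ K y = Kin y) ∧
            (∀ y : E3, 32 < ‖y‖ → ‖y‖ < 64 → G y = Gout y ∧ K y = Kout y) ∧
            ∀ y : E3, 1 < ‖y‖ → ‖y‖ < 64 → MetricCoord.hamAt G K y = 0 ∧
              ∀ v : E3, MetricCoord.momFn (EuclideanSpace.basisFun (Fin 3) ℝ).toBasis G K y v = 0) :
    ObstructionFreeAnnularGluing := by
  intro η hη
  obtain ⟨εo, μo, hε, hμ, H⟩ := hcoord η hη
  refine ⟨εo, μo, hε, hμ, ?_⟩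
  intro Din Dout sIn sOut hVin hVout hdin hdout h1 h2 h3 h4 h5
  set b := (EuclideanSpace.basisFun (Fin 3) ℝ).toBasis with hb
  obtain ⟨G, K, hG, hK, hGs, hGp, hKs, hin, hout, hvac⟩ :=
    H Din.coordH Din.coordK Dout.coordH Dout.coordK sIn sOut Din.contDiff_coordH Din.contDiff_coordK
      Dout.contDiff_coordH Dout.contDiff_coordK (fun y v w ↦ Din.h.symm y v w) (fun y v hv ↦ Din.h.pos y v hv)
      (fun y v w ↦ Din.k_symm y v w) (fun y v w ↦ Dout.h.symm y v w) (fun y v hv ↦ Dout.h.pos y v hv)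
      (fun y v w ↦ Dout.k_symm y v w) ((VacOn_iff_coord b Din 1 2).1 hVin) ((VacOn_iff_coord b Dout 32 64).1 hVout)
      hdin hdout h1 h2 h3 h4 h5
  exact core_of_fields b G K hG hK hGs hGp hKs hin hout hvac

/-- **Conversely, the fact implies its coordinate form** (so `ObstructionFreeAnnularGluing_of_coord` loses nothing):
given the fact, component fields as in the coordinate form are the components of data `Din, Dout`
(`exists_of_fields`), the fact glues them, and the components `(coordH D, coordK D)` of the glued datum are the required
fields. [cite: MaoOhTao2023, Thm 1.7, Rem 1.9, §2.1] -/
theorem coord_of_ObstructionFreeAnnularGluing (hfact : ObstructionFreeAnnularGluing) :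
    ∀ η : ℝ → ℝ, IsBump η →
      ∃ εo μo : ℝ, 0 < εo ∧ 0 < μo ∧
        ∀ (Gin Kin Gout Kout : E3 → E3 →L[ℝ] E3 →L[ℝ] ℝ) (sIn sOut : ℝ),
          ContDiff ℝ ∞ Gin → ContDiff ℝ ∞ Kin → ContDiff ℝ ∞ Gout → ContDiff ℝ ∞ Kout →
          (∀ y v w, Gin y v w = Gin y w v) → (∀ y v, v ≠ 0 → 0 < Gin y v v) → (∀ y v w, Kin y v w = Kin y w v) →
          (∀ y v w, Gout y v w = Gout y w v) → (∀ y v, v ≠ 0 → 0 < Gout y v v) →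
          (∀ y v w, Kout y v w = Kout y w v) →
          (∀ y : E3, 1 < ‖y‖ → ‖y‖ < 2 → MetricCoord.hamAt Gin Kin y = 0 ∧
            ∀ v : E3, MetricCoord.momFn (EuclideanSpace.basisFun (Fin 3) ℝ).toBasis Gin Kin y v = 0) →
          (∀ y : E3, 32 < ‖y‖ → ‖y‖ < 64 → MetricCoord.hamAt Gout Kout y = 0 ∧
            ∀ v : E3, MetricCoord.momFn (EuclideanSpace.basisFun (Fin 3) ℝ).toBasis Gout Kout y v = 0) →
          DevLE Gin Kin 1 2 sIn → DevLE Gout Kout 32 64 sOut →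
          letI ΔE := avgE η 32 Gout - avgE η 1 Gin
          letI ΔP := fun i ↦ avgP η 32 Kout i - avgP η 1 Kin i
          letI ΔC := fun i ↦ avgC η 32 Gout i - avgC η 1 Gin i
          letI ΔJ := fun i ↦ avgJ η 32 Kout i - avgJ η 1 Kin i
          Real.sqrt (∑ i, ΔP i ^ 2) < ΔE →
          ΔE < 2 * Real.sqrt (ΔE ^ 2 - ∑ i, ΔP i ^ 2) →
          ΔE < εo ^ 2 →
          Real.sqrt (∑ i, ΔC i ^ 2) + Real.sqrt (∑ i, ΔJ i ^ 2) < μo * ΔE →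
          sIn ^ 2 + sOut ^ 2 < μo * ΔE →
          ∃ G K : E3 → E3 →L[ℝ] E3 →L[ℝ] ℝ, ContDiff ℝ ∞ G ∧ ContDiff ℝ ∞ K ∧
            (∀ y v w, G y v w = G y w v) ∧ (∀ y v, v ≠ 0 → 0 < G y v v) ∧ (∀ y v w, K y v w = K y w v) ∧
            (∀ y : E3, 1 < ‖y‖ → ‖y‖ < 2 → G y = Gin y ∧ K y = Kin y) ∧
            (∀ y : E3, 32 < ‖y‖ → ‖y‖ < 64 → G y = Gout y ∧ K y = Kout y) ∧
            ∀ y : E3, 1 < ‖y‖ → ‖y‖ < 64 → MetricCoord.hamAt G K y = 0 ∧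
              ∀ v : E3, MetricCoord.momFn (EuclideanSpace.basisFun (Fin 3) ℝ).toBasis G K y v = 0 := by
  intro η hη
  obtain ⟨εo, μo, hε, hμ, H⟩ := hfact η hη
  refine ⟨εo, μo, hε, hμ, ?_⟩
  intro Gin Kin Gout Kout sIn sOut hGin hKin hGout hKout hGins hGinp hKins hGouts hGoutp hKouts hvin hvout hdin hdout
    h1 h2 h3 h4 h5
  set b := (EuclideanSpace.basisFun (Fin 3) ℝ).toBasis with hb
  obtain ⟨Din, hHin, hKin'⟩ := exists_of_fields Gin Kin hGin hKin hGins hGinp hKins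
  obtain ⟨Dout, hHout, hKout'⟩ := exists_of_fields Gout Kout hGout hKout hGouts hGoutp hKouts
  have hVin : Din.VacOn 1 2 := by rw [VacOn_iff_coord b, hHin, hKin']; exact hvin
  have hVout : Dout.VacOn 32 64 := by rw [VacOn_iff_coord b, hHout, hKout']; exact hvout
  subst hHin hKin' hHout hKout'
  obtain ⟨D, hV, hDin, hDout⟩ := H Din Dout sIn sOut hVin hVout hdin hdout h1 h2 h3 h4 h5
  refine ⟨D.coordH, D.coordK, D.contDiff_coordH, D.contDiff_coordK, fun y v w ↦ D.h.symm y v w,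
    fun y v hv ↦ D.h.pos y v hv, fun y v w ↦ D.k_symm y v w, fun y h1' h2' ↦ ?_, fun y h1' _ ↦ ?_,
    (VacOn_iff_coord b D 1 64).1 hV⟩
  · exact hDin y h2'
  · exact hDout y h1'

/-- **The fact is equivalent to its coordinate form.** [cite: MaoOhTao2023, Thm 1.7, Rem 1.9, §2.1] -/
theorem ObstructionFreeAnnularGluing_iff_coord :
    ObstructionFreeAnnularGluing ↔
    ∀ η : ℝ → ℝ, IsBump η →
      ∃ εo μo : ℝ, 0 < εo ∧ 0 < μo ∧
        ∀ (Gin Kin Gout Kout : E3 → E3 →L[ℝ] E3 →L[ℝ] ℝ) (sIn sOut : ℝ),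
          ContDiff ℝ ∞ Gin → ContDiff ℝ ∞ Kin → ContDiff ℝ ∞ Gout → ContDiff ℝ ∞ Kout →
          (∀ y v w, Gin y v w = Gin y w v) → (∀ y v, v ≠ 0 → 0 < Gin y v v) → (∀ y v w, Kin y v w = Kin y w v) →
          (∀ y v w, Gout y v w = Gout y w v) → (∀ y v, v ≠ 0 → 0 < Gout y v v) →
          (∀ y v w, Kout y v w = Kout y w v) →
          (∀ y : E3, 1 < ‖y‖ → ‖y‖ < 2 → MetricCoord.hamAt Gin Kin y = 0 ∧
            ∀ v : E3, MetricCoord.momFn (EuclideanSpace.basisFun (Fin 3) ℝ).toBasis Gin Kin y v = 0) →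
          (∀ y : E3, 32 < ‖y‖ → ‖y‖ < 64 → MetricCoord.hamAt Gout Kout y = 0 ∧
            ∀ v : E3, MetricCoord.momFn (EuclideanSpace.basisFun (Fin 3) ℝ).toBasis Gout Kout y v = 0) →
          DevLE Gin Kin 1 2 sIn → DevLE Gout Kout 32 64 sOut →
          letI ΔE := avgE η 32 Gout - avgE η 1 Gin
          letI ΔP := fun i ↦ avgP η 32 Kout i - avgP η 1 Kin i
          letI ΔC := fun i ↦ avgC η 32 Gout i - avgC η 1 Gin i
          letI ΔJ := fun i ↦ avgJ η 32 Kout i - avgJ η 1 Kin i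
          Real.sqrt (∑ i, ΔP i ^ 2) < ΔE →
          ΔE < 2 * Real.sqrt (ΔE ^ 2 - ∑ i, ΔP i ^ 2) →
          ΔE < εo ^ 2 →
          Real.sqrt (∑ i, ΔC i ^ 2) + Real.sqrt (∑ i, ΔJ i ^ 2) < μo * ΔE →
          sIn ^ 2 + sOut ^ 2 < μo * ΔE →
          ∃ G K : E3 → E3 →L[ℝ] E3 →L[ℝ] ℝ, ContDiff ℝ ∞ G ∧ ContDiff ℝ ∞ K ∧
            (∀ y v w, G y v w = G y w v) ∧ (∀ y v, v ≠ 0 → 0 < G y v v) ∧ (∀ y v w, K y v w = K y w v) ∧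
            (∀ y : E3, 1 < ‖y‖ → ‖y‖ < 2 → G y = Gin y ∧ K y = Kin y) ∧
            (∀ y : E3, 32 < ‖y‖ → ‖y‖ < 64 → G y = Gout y ∧ K y = Kout y) ∧
            ∀ y : E3, 1 < ‖y‖ → ‖y‖ < 64 → MetricCoord.hamAt G K y = 0 ∧
              ∀ v : E3, MetricCoord.momFn (EuclideanSpace.basisFun (Fin 3) ℝ).toBasis G K y v = 0 :=
  ⟨coord_of_ObstructionFreeAnnularGluing, ObstructionFreeAnnularGluing_of_coord⟩

end MaoOhTao

end Literature.Geometry.Lorentzian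

end
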